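import Summits.CriticalPhenomena.PercolationContinuityZ3.Theorems.Transplant.SkelPhiConcFaceOblRun
import Summits.CriticalPhenomena.PercolationContinuityZ3.Theorems.Transplant.SkelPhiConcFaceRouteKits
import Summits.CriticalPhenomena.PercolationContinuityZ3.Theorems.Transplant.SkelPhiConcFaceInnerKits
import Summits.CriticalPhenomena.PercolationContinuityZ3.Theorems.Transplant.PlanarCells2FaceRunR
import HarnessLib

/-!
# D″ node, (F) CLOSING at φ-level (DPRIME-SCOPE §2 L6′, M.9, R1; hp-8 column): **`Skelφ.faceOblR_concS_kits`** — the face residue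
# `Skelφ.FaceOblR G φ ⟨cellGeomSG G φ P w₀ (concRadii2S P gap gap' E₀ L'), q, δc⟩ (faceDataSG …) Δ δ₂` of the two-unit scheme of record
# with EVERY kit clause discharged down to the Step-I′ certificate at the running density `q`: part 4b's `faceOblR_concS` (radii realised
# along runs) ∘ part 9's `hkits_faceStepW'` (the face step's kit clauses, `kitClause'` + `hcon_rim'`) ∘ part 10's `hroute_faceStepW_of_sched`
# (route clause of every deep contact) ∘ part 12's `kitsAt_schedChain` (inner kits, `kitsAt_stepA_win'`) ∘ the (F) schedule of record
# `ChainPlanar.FaceRun.scheduleRO` (parts 11a–c, decoupled `BandOKR` variant after F-DP4-2: first hop + short-stride prefix + long strides, fitted into `farAS`/`M(x + du)`) — φ-level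
# re-cut of `SkelConcFaceRun.faceOblR_concS_kits` (hp-8 g24, p242872); its binder list is the (F) row of stmt-g9's SIGN-PARAMS ledger

builds on p205010 (kernel theorem, internal audit signed; external expert review pending) — nothing in this file uses p205010.
Lane `prim-bschramm`, seat `prim-hp-8` (gen 30; L6′ (F) owner); helper file (`--supports stmt-CriticalPhenomena-4575`).
* **`faceOblR_concS_kits`** (binder groups: (a) `faceOblR_concS`'s own; (b) dictionary, datum, ONE certificate `hI` at accuracy `δI`
  with `δI ≤ δ₂²`, `δI ≤ δA`, `δI ≤ δA²`; (c) the kit block of `kitClause_stepI`; (d) the face step's rooms and kit number; (e) rim numerics;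
  (f) the (F) schedule's planar parameters per axis with `TwoBandOK`, `FaceRunFit2` on the `Rlev`-enlarged face rows, the `ℓ¹`-reach and
  the count ceiling; (g) the inner chain's data, route rooms, kit number, the ∀-length chain property at `(δA ↦ δ₂²)`).
[cite: KozmaNitzan2024, §4 pp. 26–31 (Step III), Lemma 10 (pp. 17–22), Lemma 11 (pp. 22–23), Lemma 12 (pp. 23–25)]
[cite: MartineauSevero2019, Cor. 2.2]
-/

noncomputable section

open MeasureTheory ProbabilityTheory
open scoped ENNReal Classical

namespace Summit.CriticalPhenomena.PercolationContinuityZ3.Theorems.Transplant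

namespace Skelφ

open Literature.Probability.Percolation Literature.Probability.LatticeModels SimpleGraph
open Literature.Probability.Percolation.KozmaNitzan
open Literature.Probability.Percolation.KozmaNitzan.Cells (oth oth_ne eq_oth_of_ne sgOf sgOf_sign)
open Literature.Barriers.CriticalPhenomena (graphBall graphBall_finite mem_graphBall_self graphBall_mono)
open KNCells KNLevels GadgetSystem Contour ChainPlanar
open Skel (winGraph winGraph_adj winGraph_le routeW excess)
open SkelI (tanOff)
open BoxProdZ2 (ConcRadiiG Erad Frad nQ nS Realised Frad_succ Frad_le_Erad)

variable {V : Type} [DecidableEq V] [Countable V] {G : SimpleGraph V} [G.LocallyFinite] {φ : V → Site 2} {types : Finset V}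

/-- **THE FACE RESIDUE OF THE TWO-UNIT SCHEME OF RECORD, EVERY KIT CLAUSE DISCHARGED** (down to the Step-I′ certificate at the running
density): `Skelφ.FaceOblR` for `⟨cellGeomSG G φ P w₀ (concRadii2S P gap gap' E₀ L'), q, δc⟩`. [cite: KozmaNitzan2024, §4 pp. 26–31 (Step III),
Lemma 10 (pp. 17–22), Lemma 11 (pp. 22–23), Lemma 12 (pp. 23–25)] [cite: MartineauSevero2019, Cor. 2.2] -/
theorem faceOblR_concS_kits (hlip : Lip G φ) (hstep : Steps G φ) (hfr : Frames G φ types) (hκ : CylConn G φ types) {Δ : ℕ}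
    (hΔ : ∀ v, G.degree v ≤ Δ) {p : unitInterval} (hC : CylSubcritical G φ types p) {D : StepI.Data V} {off : ℕ}
    (hD : D.Λ = fatSeqOff hfr hC off) {Sz Sx Sy : Finset ℕ} {q : unitInterval} {δI δ₂ δA : ℝ}
    (hI : ∀ i ∈ StepI.index types Sz Sx Sy, 1 - δI < (bondPercolation G q).real (StepI.event G φ D i))
    (hδ₂ : 0 < δ₂) (hδA : 0 < δA) (hIδ₂ : δI ≤ δ₂ ^ 2) (hIA : δI ≤ δA) (hIA2 : δI ≤ δA ^ 2)
    -- (a) the face obligation's own data (as `faceOblR_concS`)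
    (P : PCells2) (w₀ : V) (gap gap' : ℕ → ℕ) (E₀ L' : ℕ) (δc : ℝ) (hgap : ∀ n, 1 ≤ gap n) (hgap20 : ∀ n, 20 * P.rmax ≤ gap n)
    (hE₀ : 2 ≤ E₀) (hL' : 1 ≤ L') (hφ : φ w₀ = 0) {Rlev N M : ℕ} (hRlev : Rlev + 4 ≤ 10 * P.s 0 ∧ Rlev + 4 ≤ 10 * P.s 1)
    (hRlev' : Rlev + 3 ≤ 3 * P.r 0 ∧ Rlev + 3 ≤ 3 * P.r 1)
    (hcount : 1 / (1 - (q : ℝ)) ^ (Δ * N) ≤ δ₂ * ((Finset.Icc (M + 1) Rlev).card : ℝ))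
    {η : ℝ} (hη : η ≤ δc / 2) (R₁ : ℕ → ℕ)
    (hR₁ : ∀ ρ R', R₁ ρ ≤ R' → ∀ (Rw : ℕ) (D' A' : Finset V), (∀ d ∈ D', d ∈ graphBall G w₀ Rw) →
      (∀ d ∈ D', ∀ d' ∈ D', φ d - φ d' ∈ box 2 (50 * P.rmax)) → A' ⊆ D' → (∀ a ∈ A', a ∈ graphBall G w₀ (ρ + 1)) →
        (bondPercolation G q).real (excess G w₀ R' D' A') ≤ η)
    (hgapR : ∀ ρ, 20 * P.rmax + 2 * L' + R₁ ρ ≤ gap ρ)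
    -- (c) the kit block
    {Mz : ℕ} (hMz : Mz ∈ Sz) (hkz : D.k ≤ Mz) {ℓK : Fin 2 → ℕ} (hℓK0 : ∀ I, I = 0 → ℓK I ∈ Sx) (hℓK1 : ∀ I, I = 1 → ℓK I ∈ Sy)
    {A : Fin 2 → Fin 2 → ℕ} {Rk : Fin 2 → ℕ} (hAw : ∀ I, A I = StepI.widths D.Gb D.Fb I (ℓK I)) (hRk : ∀ I, Rk I = D.R (amax (A I)))
    {ℓs Mk K Rc r₀ rs : ℕ} (hℓs : 1 ≤ ℓs) (hA : ∀ i k, A i k ≤ Mk) (hAℓ : ∀ i, A i (oth i) ≤ ℓs) (hK : ∀ i, ℓs + 1 + A i i + Rk i ≤ K)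
    (hnA : ∀ i, Mz + 1 ≤ A i i) (hnM : Mz ≤ Mk) (hρK : ∀ i, ℓs + 1 + A i i + (fatRadius hfr hC Mz + off) ≤ K)
    (hR'₁ : cylRadMax G φ types ℓs (ℓs + 2 + 2 * tanOff ℓs Mk) ≤ Rc) (hR'₂ : ∀ i, cylRadMax G φ types ℓs (ℓs + 2 + A i i + Rk i) ≤ Rc)
    (hr₀₁ : ℓs + 1 + tanOff ℓs Mk + Rc ≤ r₀) (hr₀₂ : ℓs + 2 + tanOff ℓs Mk + K ≤ r₀)
    (hrs₁ : ℓs + 2 + tanOff ℓs Mk + Rc ≤ rs) (hrs₂ : ℓs + 2 + tanOff ℓs Mk + K ≤ rs) {cU : ℕ} (hcU : ∀ i, (Δ + 1) ^ Rk i ≤ cU)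
    (hARk : ∀ i, A i i ≤ Rk i)
    -- (d) the face step's rooms and kit number
    (hMt : tanOff ℓs Mk ≤ M + 1) (kk : ℕ) (hN : kk * (Δ + 1) ^ (2 * rs) ≤ N)
    (hkk : (1 - (q : ℝ) ^ (1 + Δ * ((Δ + 1) ^ Rc + (tanOff ℓs Mk + 2)) + ((Δ + 1) ^ Rc + (tanOff ℓs Mk + 2)) * cU)) ^ kk ≤ δ₂)
    (hgap₀ : ∀ ρ, r₀ + 1 ≤ gap ρ)
    -- (e) rim numerics: inner window depth `L`, kit reach `L''`
    {L L'' : ℕ} (hLRk : ∀ i, L + Rk i ≤ L'') (hL''L' : L'' ≤ L') (hr₀L' : r₀ ≤ L') (hr₀L : r₀ ≤ L)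
    -- (f) the (F) schedule of record, per axis
    (ℓ1 : Fin 2 → ℕ) (hℓ1x : ℓ1 0 ∈ Sx) (hℓ1y : ℓ1 1 ∈ Sy) {a₁ : Fin 2 → Fin 2 → ℕ}
    (ha₁ : ∀ i, a₁ i = StepI.widths D.Gb D.Fb i (ℓ1 i)) (hka : ∀ i i', D.k ≤ a₁ i i')
    (hkR : ∀ i, fatRadius hfr hC D.k + off ≤ D.R (amax (a₁ i))) (hRtL : ∀ i, D.R (amax (a₁ i)) ≤ L)
    {q'₁ s₁ ρ₁ s₂ ρ₂ : Fin 2 → ℤ} {R'b : ℕ} {ℓ₀₁ N₁ WM₁ ℓ₀₂ WM₂ ℓ₁₁ ℓ₁₂ : Fin 2 → ℕ} {Wb₁ Wb₂ : Fin 2 → ℕ → ℕ} (N₂fn : Fin 2 → ℤ → ℕ)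
    (hOK : ∀ i lv, FaceRun.TwoBandOKR (q'₁ i) (s₁ i) (ρ₁ i) R'b (ℓ₀₁ i) (N₁ i) (WM₁ i) (Wb₁ i) (s₂ i) (ρ₂ i) (ℓ₀₂ i) (N₂fn i lv) (WM₂ i) (Wb₂ i))
    (hℓ₁₁ : ∀ i, 2 * 0 + s₁ i + R'b ≤ ℓ₁₁ i) (hℓ₁₂ : ∀ i, 2 * 0 + s₂ i + R'b ≤ ℓ₁₂ i)
    (hq'a : ∀ i, (a₁ i (oth i) : ℤ) ≤ q'₁ i) (hMzℓ1 : ∀ i, (Mz : ℤ) + s₁ i + 2 * R'b < ℓ1 i)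
    (hfit : ∀ (du : MDir) (j : ℕ), j + 1 ≤ P.K → ∀ lv cbo : ℤ, P.faceL du.1 j - Rlev ≤ lv → lv ≤ P.faceL du.1 j + Rlev →
      |cbo| ≤ 2 * (P.r (oth du.1) : ℤ) + Rlev →
      PCells2.FaceRunFit2 P du j lv cbo (ℓ1 du.1) (q'₁ du.1) (s₁ du.1) (ρ₁ du.1) R'b (N₁ du.1) (WM₁ du.1) (s₂ du.1) (ρ₂ du.1)
        (N₂fn du.1 lv) (WM₂ du.1) (a₁ du.1))
    (hreachL : ∀ i lv, |(ℓ1 i : ℤ)| + ((N₁ i : ℤ) + 1) * s₁ i + ((N₂fn i lv : ℤ) + 1) * s₂ i +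
      (q'₁ i + WM₁ i + WM₂ i + ((N₁ i : ℤ) + N₂fn i lv + 2) * R'b) ≤ L)
    {nmax : ℕ} (hnmax : ∀ i lv, N₁ i + 1 + N₂fn i lv ≤ nmax)
    -- (g) the inner chain: data, excess radius, route rooms, kit number, ∀-length chain property
    {RlevA NA j₀A j₁A Lr R₁A : ℕ} {ηA : ℝ} (hRlA : RlevA + 1 ≤ R'b) (hjA : j₁A ≤ RlevA) (hj₀A : tanOff ℓs Mk ≤ j₀A) (hηA : ηA ≤ δA / 2)
    (hcountA : 1 / (1 - (q : ℝ)) ^ (Δ * NA) ≤ δA * ((Finset.Icc j₀A j₁A).card : ℝ)) (hr₀Lr : r₀ ≤ Lr)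
    (hR₁A : ∀ (c' : V) (R'' : ℕ), R₁A ≤ R'' → ∀ (Rw : ℕ) (D' A' : Finset V), (∀ d ∈ D', d ∈ graphBall G c' Rw) →
      (∀ d ∈ D', ∀ d' ∈ D', φ d - φ d' ∈ box 2 (50 * P.rmax)) → A' ⊆ D' → (∀ a ∈ A', a ∈ graphBall G c' (fatRadius hfr hC D.k + off)) →
        (bondPercolation G q).real (excess G c' R'' D' A') ≤ ηA)
    (hRA : R₁A ≤ L - Lr) (hMℓ : ∀ i, Mz + 1 ≤ min (ℓ₀₁ i) (ℓ₀₂ i))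
    (hScert : ∀ i ℓ, min (ℓ₀₁ i) (ℓ₀₂ i) ≤ ℓ → ℓ ≤ max (ℓ₁₁ i) (ℓ₁₂ i) → (i = 0 → ℓ ∈ Sx) ∧ (i = 1 → ℓ ∈ Sy))
    (hdepthA : ∀ i I ℓ, min (ℓ₀₁ i) (ℓ₀₂ i) ≤ ℓ → ℓ ≤ max (ℓ₁₁ i) (ℓ₁₂ i) →
      2 * ℓs + 2 + tanOff ℓs Mk + A I I + D.R (amax (StepI.widths D.Gb D.Fb i ℓ)) ≤ r₀)
    (hWr : ∀ i ℓ, min (ℓ₀₁ i) (ℓ₀₂ i) ≤ ℓ → ℓ ≤ max (ℓ₁₁ i) (ℓ₁₂ i) →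
      StepI.widths D.Gb D.Fb i ℓ (oth i) ≤ Wb₁ i ℓ ∧ StepI.widths D.Gb D.Fb i ℓ (oth i) ≤ Wb₂ i ℓ)
    (kkA : ℕ) (hNA : kkA * (Δ + 1) ^ (2 * rs) ≤ NA)
    (hkkA : (1 - (q : ℝ) ^ (1 + Δ * ((Δ + 1) ^ Rc + (tanOff ℓs Mk + 2)) + ((Δ + 1) ^ Rc + (tanOff ℓs Mk + 2)) * cU)) ^ kkA ≤ δA)
    (hchain : ∀ (c : V) (n : ℕ), n ≤ nmax → ∀ (Wg : Sym2 V → unitInterval) (s : Fin (n + 1) → TStep (winGraph G c L))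
      (T' : Fin (n + 1) → Finset V) (η' : ℝ),
      (∀ i, (s i).L.o = (s 0).L.o) →
      (∀ i : Fin n, T' (Fin.castSucc i) ⊆ (s i.succ).L.X 0) →
      (∀ i, T' i ⊆ (s i).T) →
      (∀ i, (s i).KitsAt Wg q Δ δA) →
      η' ≤ δA / 2 →
      (∀ i, (prodBernoulli Wg).real (⋃ t ∈ (s i).T \ T' i, openConn (s 0).L.o t) ≤ η') →
      1 - δA < (prodBernoulli Wg).real (s 0).L.reachB →
        1 - δ₂ ^ 2 < (prodBernoulli Wg).real (⋃ t ∈ T' (Fin.last n), openConn (s 0).L.o t)) :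
    FaceOblR G φ (⟨cellGeomSG G φ P w₀ (concRadii2S P gap gap' E₀ L'), q, δc⟩ : KSchA V ℕ)
      (faceDataSG G φ P w₀ (concRadii2S P gap gap' E₀ L')) Δ δ₂ := by
  -- the certificate at the three accuracies
  have hI₂ : ∀ i ∈ StepI.index types Sz Sx Sy, 1 - δ₂ ^ 2 < (bondPercolation G q).real (StepI.event G φ D i) :=
    fun i hi => lt_of_le_of_lt (by linarith) (hI i hi)
  have hIa : ∀ i ∈ StepI.index types Sz Sx Sy, 1 - δA < (bondPercolation G q).real (StepI.event G φ D i) :=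
    fun i hi => lt_of_le_of_lt (by linarith) (hI i hi)
  have hIa2 : ∀ i ∈ StepI.index types Sz Sx Sy, 1 - δA ^ 2 < (bondPercolation G q).real (StepI.event G φ D i) :=
    fun i hi => lt_of_le_of_lt (by linarith) (hI i hi)
  refine faceOblR_concS P w₀ gap gap' E₀ L' q δc hlip hstep hgap hgap20 hE₀ hL' hφ hRlev hRlev' hcount hη R₁ hR₁ hgapR ?_
  intro h e Λ S hrun hc hV du hdu j hj o a a' Q
  -- the realised radii at the chosen edge (as in `faceOblR_concS`)
  have hΛW : WFS2 P Λ := concRadii2S_WFS2 P gap gap' E₀ L' hgap hE₀ hL'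
  have hr : Realised a a' (tgt e) := realised_of_choice_SG h hc
  have hy : tgt e + stepVec du ≠ 0 := tgt_add_stepVec_ne_zero hφ hV hdu
  set g := nQ a (tgt e) with hg
  obtain ⟨-, -, h3⟩ := hr.sched_hyps hy
  have hrM : Λ.rM a' ((tgt e) + stepVec du) = Erad gap gap' E₀ g + gap (Erad gap gap' E₀ g) - L' := by
    change Frad gap gap' E₀ (nQ a' ((tgt e) + stepVec du)) - L' = _
    rw [hr.nQ_add_stepVec hy, Frad_succ]
  have hrE : Λ.rE a' (tgt e) du = Erad gap gap' E₀ g + gap (Erad gap gap' E₀ g) - 1 := by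
    rw [concRadii2S_rE_eq P gap gap' E₀ L' h3, hr.nS_eq, Frad_succ]
  have hgapg := hgapR (Erad gap gap' E₀ g)
  have hgap0 := hgap₀ (Erad gap gap' E₀ g)
  have hr₀R : r₀ ≤ Λ.rE a' (tgt e) du := by rw [hrE]; omega
  have hL'R : L' ≤ Λ.rE a' (tgt e) du := by rw [hrE]; omega
  have hMR : Λ.rM a' ((tgt e) + stepVec du) ≤ Λ.rE a' (tgt e) du := by rw [hrM, hrE]; omega
  have hL'M : L' ≤ Λ.rM a' ((tgt e) + stepVec du) := by rw [hrM]; omega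
  have hjK : j + 1 ≤ P.K := hj
  have h01 : du.1 = 0 ∨ du.1 = 1 := by
    rcases du with ⟨i, b⟩; fin_cases i <;> simp
  have hRlev₁ : Rlev + 4 ≤ 10 * P.s du.1 := by
    rcases h01 with h0 | h0 <;> rw [h0]; exacts [hRlev.1, hRlev.2]
  have hRlev₂ : Rlev + 3 ≤ 3 * P.r (oth du.1) := by
    rcases h01 with h0 | h0 <;> rw [h0]; exacts [hRlev'.2, hRlev'.1]
  -- the law of the face step: a subbox weighting of the window graph, vanishing off `G`
  have hWD : IsSubbox (winGraph G w₀ (Λ.rE a' (tgt e) du)) (S.Wt G h e a a' du j o) q (Win G φ w₀ (P.farAS (tgt e) du j) (Λ.rE a' (tgt e) du)) :=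
    isSubbox_faceStepW (S := S) rfl hΛW hV hdu (a := a) (a' := a') (j := j) (o := o) Rlev N M L' hlip hstep
  have hWG : ∀ e', e' ∉ G.edgeSet → S.Wt G h e a a' du j o e' = 0 := fun e' he' => KSchA.Wt_eq_zero_of_not_mem_edgeSet he'
  -- nonnegativity of the strides
  have hR0 : (0 : ℤ) ≤ R'b := by positivity
  have hs₁0 : (0 : ℤ) ≤ s₁ du.1 := by have := (hOK du.1 0).ok₁.hs2; linarith
  have hs₂0 : (0 : ℤ) ≤ s₂ du.1 := by have := (hOK du.1 0).ok₂.hs2; linarith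
  refine hkits_faceStepW' hlip hstep hfr hκ hΔ hC hD hδ₂ hI₂ hMz hkz hℓK0 hℓK1 hAw hRk hℓs hA hAℓ hK hnA hnM hρK hR'₁ hR'₂ hr₀₁ hr₀₂
    hrs₁ hrs₂ hcU hARk P w₀ Λ a' (tgt e) du hjK (S.Sx G h e a a' du) hMt hRlev₁ hRlev₂ hr₀R hWD hLRk hr₀L' hL'R hMR kk hN hkk ?_
  -- the route clause of every deep contact, from the (F) schedule of record about its kit centre
  refine hroute_faceStepW_of_sched hlip hstep hfr hC hD hIa P w₀ Λ a' (tgt e) du (by omega) Rlev N M L' (S.Sx G h e a a' du) hWG hWD hL'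
    hL'M hL'R hL''L' hMt hA hK (le_trans (by omega) hr₀₂) hr₀R hkz (ℓ1 := ℓ1 du.1) (fun h0 => by rw [h0]; exact hℓ1x)
    (fun h1 => by rw [h1]; exact hℓ1y) (ha₁ du.1) rfl (hka du.1) (hkR du.1) (hRtL du.1)
    (fun c => FaceRun.scheduleRO du (φ c) (ℓ1 du.1 : ℤ) (hOK du.1 (P.lev du (tgt e) (φ c))) (hℓ₁₁ du.1) (hℓ₁₂ du.1))
    (fun c _ y h1 h2 => ?_) (fun c _ k hk y hy => ?_) (fun c _ y hy => ?_) (fun c _ k hk => ?_) (fun c hcB k hk => ?_)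
    (fun c hcB => ?_) (fun c hcB => ?_) (fun _ => rfl) hRlA hjA hηA hcountA hR₁A hRA (fun c n hn => ?_) (fun c hcB hball => ?_)
  · -- core `0` holds the landing half-side
    refine FaceRun.mem_core_zero_of_landingRO (hOK du.1 _) (hℓ₁₁ du.1) (hℓ₁₂ du.1) ?_ ((h2.trans (by exact_mod_cast le_rfl)).trans (hq'a du.1))
    rw [h1, ha₁ du.1, StepI.widths_self]
  · -- regions beyond the zone scale
    have h1 := hMzℓ1 du.1
    have h2 := FaceRun.lev_ge_of_mem_regionRO (hOK du.1 _) (hℓ₁₁ du.1) (hℓ₁₂ du.1) hk hy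
    linarith
  · -- the last core beyond the zone scale
    have h1 := (FaceRun.lev_core_lastRO (hOK du.1 _) (hℓ₁₁ du.1) (hℓ₁₂ du.1) hy).1
    have hN1 : (0 : ℤ) ≤ ((N₁ du.1 : ℤ) + 1) * s₁ du.1 := by positivity
    have hN2 : (0 : ℤ) ≤ ((N₂fn du.1 (P.lev du (tgt e) (φ c)) : ℤ) + 1) * s₂ du.1 := by positivity
    have := hMzℓ1 du.1
    linarith
  · -- `ℓ¹`-reach of the cores
    obtain ⟨y, hy⟩ := ((FaceRun.scheduleRO du (φ c) (ℓ1 du.1 : ℤ) (hOK du.1 (P.lev du (tgt e) (φ c))) (hℓ₁₁ du.1) (hℓ₁₂ du.1)).nonempty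
      (k + 1) (by exact Nat.succ_le_succ hk))
    refine ⟨y, hy, ?_⟩
    have h1 := FaceRun.reach_of_mem_core_succRO (hOK du.1 _) (hℓ₁₁ du.1) (hℓ₁₂ du.1) hk hy
    have h2 := hreachL du.1 (P.lev du (tgt e) (φ c))
    have : (((y 0 - φ c 0).natAbs + (y 1 - φ c 1).natAbs : ℕ) : ℤ) ≤ (L : ℤ) := by rw [Nat.cast_add]; linarith
    exact_mod_cast this
  · -- regions inside the shrunk far rows
    obtain ⟨hl1, hl2, hcb⟩ := PCells2.faceRow_range_of_mem P (tgt e) du j Rlev hcB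
    exact PCells2.faceRunRO_region_subset_farAS (hOK du.1 _) (hℓ₁₁ du.1) (hℓ₁₂ du.1) (hfit du j hjK _ _ hl1 hl2 hcb) hk
  · -- the last core inside `M((tgt e) + du)`
    obtain ⟨hl1, hl2, hcb⟩ := PCells2.faceRow_range_of_mem P (tgt e) du j Rlev hcB
    exact PCells2.faceRunRO_core_last_subset_M (hOK du.1 _) (hℓ₁₁ du.1) (hℓ₁₂ du.1) (hfit du j hjK _ _ hl1 hl2 hcb)
  · -- the first rectangle's footprint inside the shrunk far rows
    obtain ⟨hl1, hl2, hcb⟩ := PCells2.faceRow_range_of_mem P (tgt e) du j Rlev hcB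
    exact PCells2.faceRun_firstBox_subset_farAS (x := tgt e) (hfit du j hjK _ _ hl1 hl2 hcb)
  · -- the chain property at the schedule's length
    exact hchain c n (by rw [← hn]; exact hnmax du.1 _)
  · -- the inner kits
    obtain ⟨hl1, hl2, hcb⟩ := PCells2.faceRow_range_of_mem P (tgt e) du j Rlev hcB
    have hfitc := hfit du j hjK _ _ hl1 hl2 hcb
    set Sch := FaceRun.scheduleRO du (φ c) (ℓ1 du.1 : ℤ) (hOK du.1 (P.lev du (tgt e) (φ c))) (hℓ₁₁ du.1) (hℓ₁₂ du.1) with hSch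
    have hax : ∀ k ≤ Sch.N, Sch.ax k = du.1 := fun k hk => FaceRun.scheduleRO_ax (hOK du.1 _) (hℓ₁₁ du.1) (hℓ₁₂ du.1) hk
    have hreg : ∀ k ≤ Sch.N, ∀ y ∈ Sch.region k, (Mz : ℤ) < sgOf du * (y du.1 - φ c du.1) := fun k hk y hy => by
      have h1 := hMzℓ1 du.1
      have h2 := FaceRun.lev_ge_of_mem_regionRO (hOK du.1 _) (hℓ₁₁ du.1) (hℓ₁₂ du.1) hk hy
      linarith
    have hcS : c ∈ D.Λ c D.k := by rw [hD, mem_fatSeqOff_iff]; exact self_mem_cylBall G φ c _ _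
    have hFbox : ∀ y : Site 2, (∀ i, |y i - φ c i| ≤ a₁ du.1 i) →
        y ∈ Finset.Icc (φ c - fun i => ((a₁ du.1 i : ℕ) : ℤ)) (φ c + fun i => ((a₁ du.1 i : ℕ) : ℤ)) := fun y hy' =>
      Finset.mem_Icc.2 ⟨fun i => by have := (abs_le.1 (hy' i)).1; simp only [Pi.sub_apply]; linarith,
        fun i => by have := (abs_le.1 (hy' i)).2; simp only [Pi.add_apply]; linarith⟩
    have hSQ : D.Λ c D.k ⊆ schedQt G φ c L (Finset.Icc (φ c - fun i => ((a₁ du.1 i : ℕ) : ℤ)) (φ c + fun i => ((a₁ du.1 i : ℕ) : ℤ))) Sch := by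
      rw [hD]
      exact (fatSeqOff_subset_rectPrismFin hfr hC off (hka du.1) (hkR du.1)).trans (rectPrismFin_subset_schedQt (hRtL du.1) hFbox)
    have hSD : ∀ k ≤ Sch.N, Disjoint (D.Λ c D.k) ((planarWindowWin hlip c L).stepD Sch k) := fun k hk => by
      rw [PlanarWindow.stepD, planarWindowWin_W, hD]
      exact disjoint_fatSeqOff_Win_of_beyond hfr hC off (sgOf_sign du) fun y hy => lt_of_le_of_lt (by exact_mod_cast hkz) (hreg k hk y hy)
    have hreach : ∀ k ≤ Sch.N, ∃ y ∈ Sch.core (k + 1), (y 0 - φ c 0).natAbs + (y 1 - φ c 1).natAbs ≤ L := fun k hk => by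
      obtain ⟨y, hy⟩ := Sch.nonempty (k + 1) (by exact Nat.succ_le_succ hk)
      refine ⟨y, hy, ?_⟩
      have h1 := FaceRun.reach_of_mem_core_succRO (hOK du.1 _) (hℓ₁₁ du.1) (hℓ₁₂ du.1) hk hy
      have h2 := hreachL du.1 (P.lev du (tgt e) (φ c))
      have : (((y 0 - φ c 0).natAbs + (y 1 - φ c 1).natAbs : ℕ) : ℤ) ≤ (L : ℤ) := by rw [Nat.cast_add]; linarith
      exact_mod_cast this
    have hQ : schedQt G φ c L (Finset.Icc (φ c - fun i => ((a₁ du.1 i : ℕ) : ℤ)) (φ c + fun i => ((a₁ du.1 i : ℕ) : ℤ))) Sch ⊆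
        Win G φ w₀ (P.farAS (tgt e) du j) (Λ.rE a' (tgt e) du) :=
      schedQt_subset_Win hball (PCells2.faceRun_firstBox_subset_farAS (x := tgt e) hfitc)
        fun k hk => PCells2.faceRunRO_region_subset_farAS (hOK du.1 _) (hℓ₁₁ du.1) (hℓ₁₂ du.1) hfitc hk
    refine kitsAt_schedChain hlip hstep hfr hκ hΔ hC hD hδA hIa2 hMz hkz hℓK0 hℓK1 hAw hRk hℓs hA hAℓ hK hnA hnM hρK hR'₁ hR'₂ hr₀₁ hr₀₂
      hrs₁ hrs₂ hcU hr₀L Sch hcS hSQ hSD hreach hWG hWD (fun u hu => ((mem_Win G φ).1 hu).1) hQ hr₀Lr hRlA hjA hj₀A hcountA (hMℓ du.1)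
      (fun k hk h0 ℓ hℓ0 hℓ1 => (hScert du.1 ℓ hℓ0 hℓ1).1 (by rw [← hax k hk]; exact h0))
      (fun k hk h1 ℓ hℓ0 hℓ1 => (hScert du.1 ℓ hℓ0 hℓ1).2 (by rw [← hax k hk]; exact h1))
      (fun k hk I ℓ hℓ0 hℓ1 => by rw [hax k hk]; exact hdepthA du.1 I ℓ hℓ0 hℓ1) (fun k hk ℓ hℓ0 hℓ1 => ?_) kkA hNA hkkA
    -- the band spread of step `k` dominates the certified width
    rw [hax k hk]
    show StepI.widths D.Gb D.Fb du.1 ℓ (oth du.1) ≤ ChainPlanar.pw (N₁ du.1) (fun _ => Wb₁ du.1) (fun _ => Wb₂ du.1) k ℓ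
    unfold ChainPlanar.pw
    split_ifs
    · exact (hWr du.1 ℓ hℓ0 hℓ1).1
    · exact (hWr du.1 ℓ hℓ0 hℓ1).2

end Skelφ

end Summit.CriticalPhenomena.PercolationContinuityZ3.Theorems.Transplant

end
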